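/-
COR-CM (cell pub-hodgecm2, stage 2 of the Hodge ladder) — TRANSPOSITION SURGE, item (vi) pinning record, binder `hComp`
(REACH half), TEAM hComp row BC of `HOME/pinning/HCOMP-TABLE.md` v1.1 (D-4): BASE-CHANGE GLUE for the honest `P5` slots
(PATH A).  Seat prover-pub-hodgecm2-hcomp-compare-2-0 (`hcomp-compare-2`; path under the pub-hodgecm2 lead's blanket pre-ACK
for tabled `Transposition/HComp/<Name>.lean` files, one writer).  THEOREMS ONLY (kernel lane): the isomorphisms are delivered
in the `Nonempty (_ ≅ _)` / `Nonempty (IsColimit _)` currency of the consumer's binder `hUnif` (a `Prop`; row U5 `obtain`s them);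
no definition, no named fact, no instance, nothing asserted, no `sorry`; every landed file untouched.  (The same isomorphisms as
named `def`s — review lane — are staged as `HComp/BaseChangeCompData.lean` in the seat folder, filed only on request.)
FRAMING: HC_CM is NOT proved; nothing here discharges `hComp`/`hUnif`.
-/
import Literature.NumberTheory.Automorphic.Liu2021.AppendixC.PropC5
import Literature.AlgebraicGeometry.Motives.BaseChange
import Mathlib.CategoryTheory.Limits.Shapes.Products
import HarnessLib

/-!
# Base-change glue for the honest Prop. C.5 slots: `(X ⊗_{F,c} F) ⊗_{F,ῑ₁} ῑ₁(F) ⊗ ℂ ≅ X ⊗_{F,ι₁} ℂ`, and cofan transport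

Pure category theory over Mathlib's `Over.pullback` plus ONE identity of ring maps.  The honest instantiation of
[Liu2021] Prop. C.5's data (`PropC5Data`, TEAM hComp row U2a) fills EVERY slot `Sh τ τ'` uniformly by
`S.M ⋙ C5.baseChangeAlong c ⋙ C5.baseChangeAlong τ'.rangeRestrictField` (`X_K := M_K^{(c)}`, then `⊗_{F,τ'} τ'(F)`; hcomp-ref
ruling R-1), and the consumer (`Model.hComp_of_unif_of_alb_along`, binder `hUnif`, `Transposition/Item6PinReachAlong.lean`
:158–169) reads the slot `(τ₁, ῑ₁)`, `ῑ₁ = conj ∘ ι₁`, base-changed to `ℂ` along `ῑ₁(F) ⊆ ℂ`.  Row U5 therefore needs the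
identification of `((M ⊗_{F,c} F) ⊗_{F,ῑ₁} ῑ₁(F)) ⊗_{ῑ₁(F)} ℂ` with `M ⊗_{F,ι₁} ℂ` — transitivity of base change
([Görtz–Wedhorn I, Prop. 4.16]: «for all morphisms `S'' → S'` we have a canonical isomorphism `X_{(S')} ×_{S'} S'' ≅ X_{(S'')}`»)
along the identity of ring maps `ῑ₁(F).subtype ∘ ῑ₁.rangeRestrictField ∘ c = ῑ₁ ∘ c = ι₁` (for a CM field:
`ι₁(c x) = conj(ι₁ x)`, Mathlib `IsCMField.complexEmbedding_complexConj`) — and the transport of the record's colimit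
cofan (`UnitaryCanonicalModel.RecordSystem.pieces`, apex `M_K ⊗_{F,ι₁} ℂ`) along that isomorphism.

* BC1 `baseChangeAlong_eq` — `C5.baseChangeAlong f = Motives.baseChangeHom f` (`rfl`: both are `Over.pullback (Spec f)`);
* BC2 `nonempty_baseChangeHomComp f g : Nonempty (baseChangeHom f ⋙ baseChangeHom g ≅ baseChangeHom (g.comp f))` (Mathlib
  `Over.pullbackComp`, `Spec.map_comp`);
* BC3 `baseChangeHom_congr (h : f = g) : baseChangeHom f = baseChangeHom g`; `nonempty_baseChangeHomComp₃` (three steps along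
  `h ∘ g ∘ f = ρ`);
* BC4 `nonempty_slotIso c ι₁ ῑ₁ (h : ῑ₁.comp c = ι₁) : Nonempty (C5.baseChangeAlong c ⋙ C5.baseChangeAlong ῑ₁.rangeRestrictField ⋙
  baseChangeHom ῑ₁.fieldRange.subtype ≅ baseChangeHom ι₁)` and its CM instance `nonempty_slotIsoConj` (`c` = complex
  conjugation of the CM field `F`, `ῑ₁ = conj ∘ ι₁`), objectwise `nonempty_slotIsoConj_app` (the shape row U5 `obtain`s);
* BC5 `nonempty_isColimit_cofanMk_comp_iso` / `…_comp_inv` — a colimit cofan stays a colimit cofan after composing every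
  injection with an isomorphism of the apex (Mathlib `IsColimit.ofIsoColimit`, `Cofan.ext`).

References: U. Görtz, T. Wedhorn, *Algebraic Geometry I* (2nd ed. 2020), Prop. 4.16 and §(4.7); Y. Liu, *Fourier–Jacobi cycles
and arithmetic relative trace formula*, Camb. J. Math. 9 (2021) = arXiv:2102.11518, App. C, Prop. C.5 (TeX l. 4627–4637, the
slots `Sh(𝕍)_K ⊗_{E,τ'} τ'(E)`), Rem. C.2; Mathlib `CategoryTheory.Over.pullbackComp`.
-/

set_option autoImplicit false

noncomputable section

open CategoryTheory CategoryTheory.Limits AlgebraicGeometry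
open Literature.AlgebraicGeometry.Motives (SchemeOver baseChangeHom)
open Literature.NumberTheory.Automorphic.Liu2021.AppendixC

namespace Summit.HodgeConjecture.CorCM.HComp

/-! ## BC1–BC3: base change along ring maps is functorial in the ring map -/

section Functorial

variable {k L M N : Type} [CommRing k] [CommRing L] [CommRing M] [CommRing N]

/-- **BC1.** Liu's base change `C5.baseChangeAlong f` (the typed reading R3 of «`Sh(𝕍)_K ⊗_{E,τ'} τ'(E)`»,
`AppendixC/PropC5.lean`) IS the tree's `Motives.baseChangeHom f`: both are Mathlib's `Over.pullback (Spec f)`.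
[cite: Liu2021, Prop. C.5 l. 4630] -/
theorem baseChangeAlong_eq (f : k →+* L) : C5.baseChangeAlong f = baseChangeHom f := rfl

/-- `Over.pullback` along equal morphisms is the same functor (the `HasPullbacksAlong` instances are propositions).
[folklore] -/
theorem overPullback_congr {C : Type*} [Category C] {X Y : C} {f g : X ⟶ Y} (h : f = g)
    [HasPullbacksAlong f] [HasPullbacksAlong g] : Over.pullback f = Over.pullback g := by
  subst h
  rfl

/-- **BC2. Transitivity of base change**, functorially: `(· ⊗_f L) ⊗_g M ≅ · ⊗_{g ∘ f} M` as functors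
`SchemeOver k ⥤ SchemeOver M` ([Görtz–Wedhorn I, Prop. 4.16]; Mathlib `Over.pullbackComp` for `Spec g ≫ Spec f = Spec (g ∘ f)`).
[cite: GortzWedhorn2020, Prop. 4.16 and §(4.7)] -/
theorem nonempty_baseChangeHomComp (f : k →+* L) (g : L →+* M) :
    Nonempty (baseChangeHom f ⋙ baseChangeHom g ≅ baseChangeHom (g.comp f)) :=
  ⟨(Over.pullbackComp (Spec.map (CommRingCat.ofHom g)) (Spec.map (CommRingCat.ofHom f))).symm ≪≫
    eqToIso (overPullback_congr (by rw [← Spec.map_comp, ← CommRingCat.ofHom_comp]))⟩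

/-- **BC3.** Base change along equal ring maps is the same functor (`eqToIso` of this gives the isomorphism). [folklore] -/
theorem baseChangeHom_congr {f g : k →+* L} (h : f = g) : baseChangeHom f = baseChangeHom g := by
  subst h; rfl

/-- **BC2+BC3, three steps.** `((· ⊗_f L) ⊗_g M) ⊗_h N ≅ · ⊗_ρ N` for ring maps with `h ∘ g ∘ f = ρ`
([Görtz–Wedhorn I, Prop. 4.16] twice). [cite: GortzWedhorn2020, Prop. 4.16 and §(4.7)] -/
theorem nonempty_baseChangeHomComp₃ (f : k →+* L) (g : L →+* M) (h : M →+* N) (ρ : k →+* N)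
    (hρ : h.comp (g.comp f) = ρ) : Nonempty (baseChangeHom f ⋙ baseChangeHom g ⋙ baseChangeHom h ≅ baseChangeHom ρ) := by
  obtain ⟨e₁⟩ := nonempty_baseChangeHomComp g h
  obtain ⟨e₂⟩ := nonempty_baseChangeHomComp f (h.comp g)
  exact ⟨Functor.isoWhiskerLeft (baseChangeHom f) e₁ ≪≫ e₂ ≪≫ eqToIso (baseChangeHom_congr (by rw [← hρ]; rfl))⟩

end Functorial

/-! ## BC4: the slot isomorphism `((X ⊗_{F,c} F) ⊗_{F,ῑ₁} ῑ₁(F)) ⊗_{ῑ₁(F)} ℂ ≅ X ⊗_{F,ι₁} ℂ` -/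

section Slot

variable {F : Type} [Field F]

/-- The corestriction of `τ' : F → ℂ` to its image followed by the inclusion is `τ'`. [folklore] -/
theorem fieldRange_subtype_comp_rangeRestrictField (τ' : F →+* ℂ) :
    τ'.fieldRange.subtype.comp τ'.rangeRestrictField = τ' :=
  RingHom.ext fun _ => rfl

/-- **BC4 (general form). The slot isomorphism**: for ring maps `c : F → F` and `ι₁, ῑ₁ : F → ℂ` with `ῑ₁ ∘ c = ι₁`, base
change along `c`, then along the corestriction `ῑ₁ : F → ῑ₁(F)` (Liu's slot `X_K ⊗_{E,τ'} τ'(E)` at `τ' = ῑ₁`, [Liu2021]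
Prop. C.5 l. 4630, with `X_K := M_K^{(c)}`), then along the inclusion `ῑ₁(F) ⊆ ℂ` (the consumer's reading of the slot in
`ℂ`), is naturally isomorphic to base change along `ι₁` — transitivity of base change along
`ῑ₁(F).subtype ∘ ῑ₁.rangeRestrictField ∘ c = ῑ₁ ∘ c = ι₁`. [cite: GortzWedhorn2020, Prop. 4.16 and §(4.7)]
[cite: Liu2021, Prop. C.5 l. 4627–4637] -/
theorem nonempty_slotIso (c : F →+* F) (ι₁ ῑ₁ : F →+* ℂ) (h : ῑ₁.comp c = ι₁) :
    Nonempty (C5.baseChangeAlong c ⋙ C5.baseChangeAlong ῑ₁.rangeRestrictField ⋙ baseChangeHom ῑ₁.fieldRange.subtype ≅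
      baseChangeHom ι₁) :=
  nonempty_baseChangeHomComp₃ c ῑ₁.rangeRestrictField ῑ₁.fieldRange.subtype ι₁
    (by rw [← RingHom.comp_assoc, fieldRange_subtype_comp_rangeRestrictField, h])

/-- What the slot isomorphism identifies objectwise: `((X ⊗_c F) ⊗_{ῑ₁} ῑ₁(F)) ⊗ ℂ ≅ X ⊗_{ι₁} ℂ` (the component `.app X`;
`Functor.comp_obj` is definitional). [cite: GortzWedhorn2020, Prop. 4.16 and §(4.7)] -/
theorem nonempty_slotIso_app (c : F →+* F) (ι₁ ῑ₁ : F →+* ℂ) (h : ῑ₁.comp c = ι₁) (X : SchemeOver F) :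
    Nonempty ((baseChangeHom ῑ₁.fieldRange.subtype).obj
        ((C5.baseChangeAlong ῑ₁.rangeRestrictField).obj ((C5.baseChangeAlong c).obj X)) ≅
      (baseChangeHom ι₁).obj X) := by
  obtain ⟨e⟩ := nonempty_slotIso c ι₁ ῑ₁ h
  exact ⟨e.app X⟩

/-- **BC4 (CM instance).** For a CM number field `F` with complex conjugation `c` (Mathlib `IsCMField.complexConj`) and a
complex embedding `ι₁`, with `ῑ₁ := conj ∘ ι₁`: `ῑ₁ ∘ c = ι₁` (`IsCMField.complexEmbedding_complexConj`: `ι₁ (c x) =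
conj (ι₁ x)`), so `((X ⊗_{F,c} F) ⊗_{F,ῑ₁} ῑ₁(F)) ⊗_{ῑ₁(F)} ℂ ≅ X ⊗_{F,ι₁} ℂ` naturally in `X` — the `(τ₁, ῑ₁)` slot of the
honest `P5` (PATH A, package P2′: transport along `ι₁`, never along `ῑ₁` alone) read in `ℂ` IS the record's
`M_K ⊗_{F,ι₁} ℂ`. [cite: GortzWedhorn2020, Prop. 4.16 and §(4.7)] [cite: Liu2021, Prop. C.5 l. 4627–4637 and Rem. C.2] -/
theorem nonempty_slotIsoConj (F : Type) [Field F] [NumberField F] [NumberField.IsCMField F] (ι₁ : F →+* ℂ) :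
    Nonempty (C5.baseChangeAlong (NumberField.IsCMField.complexConj F).toRingEquiv.toRingHom ⋙
        C5.baseChangeAlong ((starRingEnd ℂ).comp ι₁).rangeRestrictField ⋙
          baseChangeHom ((starRingEnd ℂ).comp ι₁).fieldRange.subtype ≅
      baseChangeHom ι₁) :=
  nonempty_slotIso (NumberField.IsCMField.complexConj F).toRingEquiv.toRingHom ι₁ ((starRingEnd ℂ).comp ι₁)
    (RingHom.ext fun x => by
      simp only [RingHom.coe_comp, Function.comp_apply, RingEquiv.toRingHom_eq_coe, RingHom.coe_coe,
        AlgEquiv.coe_ringEquiv, NumberField.IsCMField.complexEmbedding_complexConj, starRingEnd_self_apply])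

/-- **BC4 (CM instance), objectwise** — the shape row U5 `obtain`s: for an `F`-scheme `M` (the record's `M_K`),
`((M ⊗_{F,c} F) ⊗_{F,ῑ₁} ῑ₁(F)) ⊗_{ῑ₁(F)} ℂ ≅ M ⊗_{F,ι₁} ℂ`, `ῑ₁ = conj ∘ ι₁`, `c` = complex conjugation of `F`
(`cmConjRingHom F` unfolds to the spelling used here). [cite: GortzWedhorn2020, Prop. 4.16 and §(4.7)]
[cite: Liu2021, Prop. C.5 l. 4627–4637 and Rem. C.2] -/
theorem nonempty_slotIsoConj_app (F : Type) [Field F] [NumberField F] [NumberField.IsCMField F] (ι₁ : F →+* ℂ)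
    (M : SchemeOver F) :
    Nonempty ((baseChangeHom ((starRingEnd ℂ).comp ι₁).fieldRange.subtype).obj
        ((C5.baseChangeAlong ((starRingEnd ℂ).comp ι₁).rangeRestrictField).obj
          ((C5.baseChangeAlong (NumberField.IsCMField.complexConj F).toRingEquiv.toRingHom).obj M)) ≅
      (baseChangeHom ι₁).obj M) := by
  obtain ⟨e⟩ := nonempty_slotIsoConj F ι₁
  exact ⟨e.app M⟩

/-- The identity of ring maps behind `slotIsoConj`: `(conj ∘ ι₁) ∘ c = ι₁` for the complex conjugation `c` of a CM field
(`ι₁ (c x) = conj (ι₁ x)`, Mathlib `IsCMField.complexEmbedding_complexConj`). [folklore] -/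
theorem conj_comp_comp_complexConj (F : Type) [Field F] [NumberField F] [NumberField.IsCMField F] (ι₁ : F →+* ℂ) :
    ((starRingEnd ℂ).comp ι₁).comp (NumberField.IsCMField.complexConj F).toRingEquiv.toRingHom = ι₁ :=
  RingHom.ext fun x => by
    simp only [RingHom.coe_comp, Function.comp_apply, RingEquiv.toRingHom_eq_coe, RingHom.coe_coe,
      AlgEquiv.coe_ringEquiv, NumberField.IsCMField.complexEmbedding_complexConj, starRingEnd_self_apply]

/-- The image subfields of `ι₁` and `ῑ₁ = conj ∘ ι₁` coincide for a CM field (`conj (ι₁ x) = ι₁ (c x)`), so the slot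
`ῑ₁(F)` of the honest `P5` and the reflex field `ι₁(F)` of the record are the same subfield of `ℂ`. [folklore] -/
theorem fieldRange_conj_comp_eq (F : Type) [Field F] [NumberField F] [NumberField.IsCMField F] (ι₁ : F →+* ℂ) :
    ((starRingEnd ℂ).comp ι₁).fieldRange = ι₁.fieldRange := by
  ext z
  simp only [RingHom.mem_fieldRange, RingHom.coe_comp, Function.comp_apply]
  constructor
  · rintro ⟨x, rfl⟩
    exact ⟨NumberField.IsCMField.complexConj F x, NumberField.IsCMField.complexEmbedding_complexConj F ι₁ x⟩
  · rintro ⟨x, rfl⟩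
    refine ⟨NumberField.IsCMField.complexConj F x, ?_⟩
    rw [NumberField.IsCMField.complexEmbedding_complexConj, starRingEnd_self_apply]

end Slot

/-! ## BC5: transporting a colimit cofan along an isomorphism of the apex -/

section Cofan

variable {C : Type*} [Category C] {J : Type*} {X : J → C} {P P' : C}

/-- **BC5.** If `(P, ι)` is a colimit cofan of the family `X` and `e : P ≅ P'`, then `(P', ι ≫ e)` is a colimit cofan
(Mathlib `IsColimit.ofIsoColimit` along `Cofan.ext e`), in the `Nonempty` currency of the binder `hUnif`
(`Nonempty (IsColimit (Cofan.mk _ inj))`).  Used with the record's `pieces` cofan (apex `M_K ⊗_{F,ι₁} ℂ`) and the inverse of the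
slot isomorphism to present the honest slot as the coproduct of the same pieces. [folklore] -/
theorem nonempty_isColimit_cofanMk_comp_iso (inj : ∀ j, X j ⟶ P) (h : Nonempty (IsColimit (Cofan.mk P inj)))
    (e : P ≅ P') : Nonempty (IsColimit (Cofan.mk P' fun j => inj j ≫ e.hom)) :=
  ⟨h.some.ofIsoColimit (Cofan.ext e fun _ => rfl)⟩

/-- BC5 along the INVERSE of an isomorphism `e : P' ≅ P` (the shape `inj q := ι q ≫ e_slot.inv` of row U5). [folklore] -/
theorem nonempty_isColimit_cofanMk_comp_inv (inj : ∀ j, X j ⟶ P) (h : Nonempty (IsColimit (Cofan.mk P inj)))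
    (e : P' ≅ P) : Nonempty (IsColimit (Cofan.mk P' fun j => inj j ≫ e.inv)) :=
  nonempty_isColimit_cofanMk_comp_iso inj h e.symm

end Cofan

end Summit.HodgeConjecture.CorCM.HComp

end
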